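import Literature.InformationTheory.StateDiscrimination.QuantumFisherInformationMatrixFormulas
import HarnessLib

/-!
# The QFIM of a unitary parametrisation process `ρ = Uρ₀U†` with a mixed probe: the eigenbasis form
# `𝓕_ab = Σ_{ij} 2(λ_i−λ_j)²Re(𝓗_a,ij𝓗_b,ji)/(λ_i+λ_j)`, Theorem 2.7
# `𝓕_ab = Σ_i 4λ_i cov_{|λ_i⟩}(𝓗_a,𝓗_b) − Σ_{i≠j} 8λ_iλ_j/(λ_i+λ_j) Re(⟨λ_i|𝓗_a|λ_j⟩⟨λ_j|𝓗_b|λ_i⟩)`, its pure-probe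
# corollary, and the single-qubit mixed form `𝓕_ab = 4[2Tr(ρ₀²)−1]Re(⟨λ₀|𝓗_a|λ₁⟩⟨λ₁|𝓗_b|λ₀⟩)`
# (Liu–Yuan–Lu–Wang 2020 § 2.3.4 Thm 2.7, Cor. 3 and the displays after it)

Hodge foundations lane (`lit-hodgefound`, prover p24 gen 80; quantum-information series).  THEOREMS ONLY: no
definition, no named fact, net debt 0.  Data: the eigenbasis `W` of the parametrised state (`W = UV` with
`ρ₀ = V diag(λ) V†`; `W†W = WW† = 1`), real eigenvalues `λ` (any rank, any signs), the generators written in that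
basis `h a = V†𝓗_aV` (Hermitian), the state `ρ = W diag(λ) W†` and the derivative data
`∂_aρ = (∂_aU)ρ₀U† + Uρ₀(∂_aU†) = iU[𝓗_a, ρ₀]U† = W(i[h_a, diag λ])W†` (from `𝓗_a := i(∂_aU†)U`, so
`∂_aU = iU𝓗_a`) — spelled out as a hypothesis and derived from `U, V, 𝓗_a` in `deriv_unitary_process`; SLDs
`S_aρ + ρS_a = ∂_aρ` (BF normalisation) and `hF : F a b = 2Re Tr(S_a∂_bρ)` as in g80-#1/#4.

## Source, VERBATIM

J. Liu, H. Yuan, X.-M. Lu, X. Wang, J. Phys. A 53 (2020) 023001 [LiuYuanLuWang2020], held `paper:arxiv-1907.08037`,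
§ 2.3.4 (p0008): «For a `x⃗`-dependent unitary process `U = U(x⃗)`, the parameterized state `ρ` can be written as
`ρ = Uρ₀U†`, where `ρ₀` is the initial probe state which is `x⃗`-independent. … **Theorem 2.7** For a unitary
parametrization process `U`, the entry of QFIM can be obtained as [LiuSR]
`𝓕_ab = Σ_{λ_i∈S} 4λ_i cov_{|λ_i⟩}(𝓗_a,𝓗_b) − Σ_{λ_i,λ_j∈S, i≠j} 8λ_iλ_j/(λ_i+λ_j) Re(⟨λ_i|𝓗_a|λ_j⟩⟨λ_j|𝓗_b|λ_i⟩)`,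
where `λ_i` and `|λ_i⟩` are `i`th eigenvalue and eigenstate of the initial probe state `ρ₀`.
`cov_{|λ_i⟩}(𝓗_a,𝓗_b)` is defined in equation (cov_definition) [`½⟨{𝓗_a,𝓗_b}⟩ − ⟨𝓗_a⟩⟨𝓗_b⟩`]. The operator
`𝓗_a` is defined as `𝓗_a := i(∂_aU†)U = −iU†(∂_aU)`. … **Corollary 3** For a unitary process `U` with a pure
probe state `|ψ₀⟩`, … `𝓕_ab = 4cov_{|ψ₀⟩}(𝓗_a,𝓗_b)` … For a single-qubit mixed state `ρ₀` under a unitary process,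
the QFIM can be written as `𝓕_ab = 4[2Tr(ρ₀²) − 1]cov_{|λ₀⟩}(𝓗_a,𝓗_b)` with `|λ₀⟩` an eigenstate of `ρ₀`. This
equation is equivalent to `𝓕_ab = 4[2Tr(ρ₀²) − 1]Re(⟨λ₀|𝓗_a|λ₁⟩⟨λ₁|𝓗_b|λ₀⟩)`. The diagonal entry reads
`𝓕_aa = 4[2Tr(ρ₀²) − 1]|⟨λ₀|𝓗_a|λ₁⟩|²`.»

## Roads (no definitions introduced)

* § 1 `W†∂_aρW = i[h_a, diag λ]` has entries `i(λ_j − λ_i)h_a,ij`; g80-#4 `qfim_eq_sum_eigenbasis` then gives the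
  eigenbasis form **`𝓕_ab = Σ_{ij} 2(λ_i−λ_j)²Re(h_a,ij h_b,ji)/(λ_i+λ_j)`** (terms with `λ_i+λ_j = 0` are `0`).
* § 2 (Thm 2.7): termwise `2(λ_i−λ_j)²/(λ_i+λ_j) = 2(λ_i+λ_j) − 8λ_iλ_j/(λ_i+λ_j)` (also when `λ_i+λ_j = 0`, both
  sides `0`); `Σ_{ij}2(λ_i+λ_j)Re(h_a,ijh_b,ji) = Σ_i 4λ_iRe(h_ah_b)_ii` (Hermiticity), and the `i = j` terms of the
  second sum are `4λ_i h_a,ii h_b,ii`, so `cov_{|λ_i⟩}(𝓗_a,𝓗_b) = Re(h_ah_b)_ii − h_a,iih_b,ii` appears.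
* § 3 pure probe (`λ = e_{i₀}`): the cross terms carry `λ_iλ_j = 0`; single qubit: only `(0,1),(1,0)` survive in
  § 1 and `(λ₀−λ₁)² = 2(λ₀²+λ₁²) − 1` for `λ₀+λ₁ = 1`.

## What is formalized (all PROVED)

* § 1 `commutator_diagonal_apply`, `deriv_unitary_process` (`iU[𝓗,ρ₀]U† = W(i[h, diag λ])W†` with `W = UV`,
  `h = V†𝓗V`), `unitary_process_isUnitary` (`W†W = WW† = 1`), **`qfim_unitary_process_eigenbasis`**.
* § 2 `two_mul_sq_sub_div`, `sum_sum_two_mul_add`, `sum_sum_diag_part`, **`qfim_unitary_process`** (THM 2.7).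
* § 3 **`qfim_unitary_process_pure`** (Cor. 3 as the `λ = e_{i₀}` case), **`qfim_unitary_process_qubit`**
  (`𝓕_ab = 4[2Tr(ρ₀²)−1]Re(⟨λ₀|𝓗_a|λ₁⟩⟨λ₁|𝓗_b|λ₀⟩)` for `n = Fin 2`), `qfi_unitary_process_qubit` (the diagonal).

NOT formalized: `𝓗_a` as a derivative of `U(x⃗)` (it is data here), Thms 2.8–2.10 (expansions of `𝓗_a`), the
SU(2)/optical examples.  Tree search (FAIL-DUP, 2026-09-01): one-parameter `QFIVariance.qfi_unitary_eq_sum_eigenbasis`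
(`𝓘 = 2Σ(λ_i−λ_j)²|H_ij|²/(λ_i+λ_j)`, g79) is the diagonal `a = b` of § 1 in the `e^{−iθH}` convention; the pure
probe QFIM is g80-#5 `PureQGT.qfim_unitary_pure` (different road); Thm 2.7 itself is new.
-/

noncomputable section

open Matrix Finset
open scoped ComplexOrder ComplexConjugate

namespace Literature.InformationTheory.StateDiscrimination.UnitaryProcess

open Literature.InformationTheory.StateDiscrimination.QFIMFormulas (qfim_eq_sum_eigenbasis)

variable {n ι : Type*} [Fintype n] [DecidableEq n]

/-! ## § 1 The derivative in the eigenbasis and the eigenbasis form of the QFIM -/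

/-- `(i[h, diag λ])_ij = i(λ_j − λ_i)h_ij`. [cite: LiuYuanLuWang2020, §2.3.4 (proof of Thm 2.7, Appendix)] -/
theorem commutator_diagonal_apply (h : Matrix n n ℂ) (d : n → ℝ) (i j : n) :
    (Complex.I • (h * diagonal (fun k => (d k : ℂ)) - diagonal (fun k => (d k : ℂ)) * h)) i j =
      Complex.I * ((d j : ℂ) - d i) * h i j := by
  rw [Matrix.smul_apply, Matrix.sub_apply, mul_diagonal, diagonal_mul, smul_eq_mul]
  ring

/-- **`∂_aρ = iU[𝓗_a,ρ₀]U† = W(i[h_a, diag λ])W†`** with `W = UV`, `ρ₀ = V diag(λ) V†` (`VV† = 1`) and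
`h_a = V†𝓗_aV` (only `VV† = 1` is used). [cite: LiuYuanLuWang2020, §2.3.4 («`ρ = Uρ₀U†` … `𝓗_a := i(∂_aU†)U = −iU†(∂_aU)`»)] -/
theorem deriv_unitary_process {U V Hc : Matrix n n ℂ} (hV' : V * Vᴴ = 1) (d : n → ℝ) :
    Complex.I • (U * (Hc * (V * diagonal (fun k => (d k : ℂ)) * Vᴴ) - (V * diagonal (fun k => (d k : ℂ)) * Vᴴ) * Hc) * Uᴴ) =
      (U * V) * (Complex.I • ((Vᴴ * Hc * V) * diagonal (fun k => (d k : ℂ)) -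
        diagonal (fun k => (d k : ℂ)) * (Vᴴ * Hc * V))) * (U * V)ᴴ := by
  rw [conjTranspose_mul, Matrix.mul_smul, Matrix.smul_mul, Matrix.mul_sub, Matrix.sub_mul, Matrix.mul_sub,
    Matrix.sub_mul]
  congr 1
  have e1 : U * (Hc * (V * diagonal (fun k => (d k : ℂ)) * Vᴴ)) * Uᴴ =
      U * V * (Vᴴ * Hc * V * diagonal (fun k => (d k : ℂ))) * (Vᴴ * Uᴴ) := by
    calc U * (Hc * (V * diagonal (fun k => (d k : ℂ)) * Vᴴ)) * Uᴴ
        = U * (V * Vᴴ) * Hc * V * diagonal (fun k => (d k : ℂ)) * Vᴴ * Uᴴ := by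
          rw [hV', Matrix.mul_one]; simp only [Matrix.mul_assoc]
      _ = U * V * (Vᴴ * Hc * V * diagonal (fun k => (d k : ℂ))) * (Vᴴ * Uᴴ) := by simp only [Matrix.mul_assoc]
  have e2 : U * (V * diagonal (fun k => (d k : ℂ)) * Vᴴ * Hc) * Uᴴ =
      U * V * (diagonal (fun k => (d k : ℂ)) * (Vᴴ * Hc * V)) * (Vᴴ * Uᴴ) := by
    calc U * (V * diagonal (fun k => (d k : ℂ)) * Vᴴ * Hc) * Uᴴ
        = U * V * diagonal (fun k => (d k : ℂ)) * Vᴴ * Hc * (V * Vᴴ) * Uᴴ := by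
          rw [hV', Matrix.mul_one]; simp only [Matrix.mul_assoc]
      _ = U * V * (diagonal (fun k => (d k : ℂ)) * (Vᴴ * Hc * V)) * (Vᴴ * Uᴴ) := by simp only [Matrix.mul_assoc]
  rw [e1, e2]

/-- `W = UV` is unitary when `U` and `V` are (the eigenbasis of `ρ = Uρ₀U†`). [cite: LiuYuanLuWang2020, §2.3.4 Thm 2.7 («`λ_i` and `|λ_i⟩` are `i`th eigenvalue and eigenstate of the initial probe state `ρ₀`»)] -/
theorem unitary_process_isUnitary {U V : Matrix n n ℂ} (hU : Uᴴ * U = 1) (hU' : U * Uᴴ = 1) (hV : Vᴴ * V = 1)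
    (hV' : V * Vᴴ = 1) : (U * V)ᴴ * (U * V) = 1 ∧ (U * V) * (U * V)ᴴ = 1 := by
  constructor
  · calc (U * V)ᴴ * (U * V) = Vᴴ * (Uᴴ * U) * V := by rw [conjTranspose_mul]; simp only [Matrix.mul_assoc]
      _ = 1 := by rw [hU, Matrix.mul_one, hV]
  · calc U * V * (U * V)ᴴ = U * (V * Vᴴ) * Uᴴ := by rw [conjTranspose_mul]; simp only [Matrix.mul_assoc]
      _ = 1 := by rw [hV', Matrix.mul_one, hU']

/-- `U†(WXW†)U`-bookkeeping: `W†(WXW†)W = X` for `W†W = 1`. [folklore] -/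
private theorem conjTranspose_conj {W : Matrix n n ℂ} (hW : Wᴴ * W = 1) (X : Matrix n n ℂ) :
    Wᴴ * (W * X * Wᴴ) * W = X := by
  calc Wᴴ * (W * X * Wᴴ) * W = (Wᴴ * W) * X * (Wᴴ * W) := by simp only [Matrix.mul_assoc]
    _ = X := by rw [hW, Matrix.one_mul, Matrix.mul_one]

/-- **The eigenbasis form of the QFIM of a unitary process**: with `ρ = W diag(λ) W†`,
`∂_aρ = W(i[h_a, diag λ])W†` (`h_a` the generator in the probe's eigenbasis) and ANY SLDs,
`𝓕_ab = Σ_i Σ_j 2(λ_i−λ_j)² Re(h_a,ij h_b,ji)/(λ_i+λ_j)` (terms with `λ_i+λ_j = 0` are `0`).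
[cite: LiuYuanLuWang2020, §2.3.4 Thm 2.7 (with §2.3.1 Thm 2.1)] -/
theorem qfim_unitary_process_eigenbasis [Fintype ι] {W : Matrix n n ℂ} (hW : Wᴴ * W = 1) (hW' : W * Wᴴ = 1)
    (d : n → ℝ) (h : ι → Matrix n n ℂ) {ρ : Matrix n n ℂ} (hρ : ρ = W * diagonal (fun k => (d k : ℂ)) * Wᴴ)
    {S D : ι → Matrix n n ℂ}
    (hD : ∀ a, D a = W * (Complex.I • (h a * diagonal (fun k => (d k : ℂ)) - diagonal (fun k => (d k : ℂ)) * h a)) * Wᴴ)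
    (hSD : ∀ a, S a * ρ + ρ * S a = D a) {F : Matrix ι ι ℝ} (hF : ∀ a b, F a b = 2 * (S a * D b).trace.re)
    (a b : ι) :
    F a b = ∑ i, ∑ j, 2 * (d i - d j) ^ 2 * (h a i j * h b j i).re / (d i + d j) := by
  rw [qfim_eq_sum_eigenbasis hW hW' d hρ hSD hF a b]
  refine Finset.sum_congr rfl fun i _ => Finset.sum_congr rfl fun j _ => ?_
  rw [hD, hD, conjTranspose_conj hW, conjTranspose_conj hW, commutator_diagonal_apply, commutator_diagonal_apply]
  have e : Complex.I * ((d j : ℂ) - d i) * h a i j * (Complex.I * ((d i : ℂ) - d j) * h b j i) =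
      (((d i - d j) ^ 2 : ℝ) : ℂ) * (h a i j * h b j i) := by
    have hI : Complex.I * Complex.I = -1 := Complex.I_mul_I
    push_cast
    linear_combination ((d j : ℂ) - d i) * ((d i : ℂ) - d j) * h a i j * h b j i * hI
  rw [e, Complex.re_ofReal_mul]
  ring

/-! ## § 2 Theorem 2.7 -/

omit [Fintype n] [DecidableEq n] in
/-- Termwise: `2(λ_i−λ_j)²x/(λ_i+λ_j) = 2(λ_i+λ_j)x − 8λ_iλ_jx/(λ_i+λ_j)` (both sides `0` when `λ_i+λ_j = 0`). [cite: LiuYuanLuWang2020, §2.3.4 Thm 2.7 (proof)] -/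
theorem two_mul_sq_sub_div (u v x : ℝ) :
    2 * (u - v) ^ 2 * x / (u + v) = 2 * (u + v) * x - 8 * u * v * x / (u + v) := by
  by_cases huv : u + v = 0
  · have hv : v = -u := by linarith
    subst hv
    simp
  · field_simp
    ring

omit [DecidableEq n] in
/-- `Σ_{ij} 2(λ_i+λ_j)Re(h_a,ijh_b,ji) = Σ_i 4λ_iRe(h_ah_b)_ii` for Hermitian `h_a, h_b`. [cite: LiuYuanLuWang2020, §2.3.4 Thm 2.7 (proof)] -/
theorem sum_sum_two_mul_add {ha hb : Matrix n n ℂ} (hha : ha.IsHermitian) (hhb : hb.IsHermitian) (d : n → ℝ) :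
    ∑ i, ∑ j, 2 * (d i + d j) * (ha i j * hb j i).re = ∑ i, 4 * d i * ((ha * hb) i i).re := by
  have hdiag : ∀ i, ((ha * hb) i i).re = ∑ j, (ha i j * hb j i).re := fun i => by
    rw [Matrix.mul_apply, Complex.re_sum]
  -- the `(h_b h_a)_jj` half, by Hermiticity `Re(h_a,ij h_b,ji) = Re(h_a,ji h_b,ij)`
  have hsymm : ∀ i j, (ha i j * hb j i).re = (ha j i * hb i j).re := fun i j => by
    have e1 : ha i j = star (ha j i) := by rw [← conjTranspose_apply, hha.eq]
    have e2 : hb j i = star (hb i j) := by rw [← conjTranspose_apply, hhb.eq]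
    rw [e1, e2, ← star_mul, mul_comm, Complex.star_def, Complex.conj_re]
  have hsplit : ∀ i j, 2 * (d i + d j) * (ha i j * hb j i).re =
      2 * d i * (ha i j * hb j i).re + 2 * d j * (ha j i * hb i j).re := fun i j => by
    rw [← hsymm i j]; ring
  simp_rw [hsplit, Finset.sum_add_distrib]
  rw [Finset.sum_comm (f := fun i j => 2 * d j * (ha j i * hb i j).re)]
  rw [← Finset.sum_add_distrib]
  refine Finset.sum_congr rfl fun i _ => ?_
  rw [hdiag, Finset.mul_sum, ← Finset.sum_add_distrib]
  exact Finset.sum_congr rfl fun j _ => by ring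

omit [Fintype n] in
/-- The `i = j` terms of `Σ 8λ_iλ_jRe(h_a,ijh_b,ji)/(λ_i+λ_j)` are `4λ_ih_a,iih_b,ii`. [cite: LiuYuanLuWang2020, §2.3.4 Thm 2.7 (proof)] -/
theorem sum_sum_diag_part [Fintype n] (ha hb : Matrix n n ℂ) (d : n → ℝ) :
    ∑ i, ∑ j, 8 * d i * d j * (ha i j * hb j i).re / (d i + d j) =
      ∑ i, 4 * d i * (ha i i * hb i i).re +
        ∑ i, ∑ j, (if i = j then 0 else 8 * d i * d j * (ha i j * hb j i).re / (d i + d j)) := by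
  rw [← Finset.sum_add_distrib]
  refine Finset.sum_congr rfl fun i _ => ?_
  have hsplit : ∀ j, 8 * d i * d j * (ha i j * hb j i).re / (d i + d j) =
      (if i = j then 8 * d i * d j * (ha i j * hb j i).re / (d i + d j) else 0) +
      (if i = j then 0 else 8 * d i * d j * (ha i j * hb j i).re / (d i + d j)) := fun j => by
    split_ifs <;> simp
  rw [Finset.sum_congr rfl fun j _ => hsplit j, Finset.sum_add_distrib, Finset.sum_ite_eq, if_pos (Finset.mem_univ i)]
  congr 1
  by_cases hdi : d i = 0
  · simp [hdi]
  · field_simp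
    ring

/-- **Theorem 2.7 (Liu et al.; [LiuSR])**: for a unitary parametrisation process with probe spectrum `λ` and
generators `h_a = V†𝓗_aV` in the probe's eigenbasis (data as in `qfim_unitary_process_eigenbasis`, any SLDs),
`𝓕_ab = Σ_i 4λ_i[Re(h_ah_b)_ii − Re(h_a,ii h_b,ii)] − Σ_{i≠j} 8λ_iλ_j Re(h_a,ij h_b,ji)/(λ_i+λ_j)`, i.e.
`Σ_i 4λ_i cov_{|λ_i⟩}(𝓗_a,𝓗_b) − Σ_{i≠j} 8λ_iλ_j/(λ_i+λ_j) Re(⟨λ_i|𝓗_a|λ_j⟩⟨λ_j|𝓗_b|λ_i⟩)` with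
`cov_{|λ_i⟩}(𝓗_a,𝓗_b) = ½⟨λ_i|{𝓗_a,𝓗_b}|λ_i⟩ − ⟨λ_i|𝓗_a|λ_i⟩⟨λ_i|𝓗_b|λ_i⟩ = Re(h_ah_b)_ii − h_a,iih_b,ii`
(vanishing eigenvalues drop out by themselves). [cite: LiuYuanLuWang2020, §2.3.4 Thm 2.7] -/
theorem qfim_unitary_process [Fintype ι] {W : Matrix n n ℂ} (hW : Wᴴ * W = 1) (hW' : W * Wᴴ = 1) (d : n → ℝ)
    {h : ι → Matrix n n ℂ} (hh : ∀ a, (h a).IsHermitian) {ρ : Matrix n n ℂ}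
    (hρ : ρ = W * diagonal (fun k => (d k : ℂ)) * Wᴴ) {S D : ι → Matrix n n ℂ}
    (hD : ∀ a, D a = W * (Complex.I • (h a * diagonal (fun k => (d k : ℂ)) - diagonal (fun k => (d k : ℂ)) * h a)) * Wᴴ)
    (hSD : ∀ a, S a * ρ + ρ * S a = D a) {F : Matrix ι ι ℝ} (hF : ∀ a b, F a b = 2 * (S a * D b).trace.re)
    (a b : ι) :
    F a b = ∑ i, 4 * d i * (((h a * h b) i i).re - (h a i i * h b i i).re) -
      ∑ i, ∑ j, (if i = j then 0 else 8 * d i * d j * (h a i j * h b j i).re / (d i + d j)) := by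
  rw [qfim_unitary_process_eigenbasis hW hW' d h hρ hD hSD hF a b]
  simp_rw [two_mul_sq_sub_div, Finset.sum_sub_distrib]
  rw [sum_sum_two_mul_add (hh a) (hh b), sum_sum_diag_part, ← sub_sub, ← Finset.sum_sub_distrib]
  congr 1
  exact Finset.sum_congr rfl fun i _ => by ring

/-! ## § 3 Pure probe (Cor. 3) and the single qubit -/

/-- **Corollary 3 (pure probe)**: with spectrum `λ = e_{i₀}` (`ρ₀ = |λ_{i₀}⟩⟨λ_{i₀}|`),
`𝓕_ab = 4[Re(h_ah_b)_{i₀i₀} − h_a,i₀i₀h_b,i₀i₀] = 4cov_{|ψ₀⟩}(𝓗_a,𝓗_b)` — the cross terms carry `λ_iλ_j = 0`.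
[cite: LiuYuanLuWang2020, §2.3.4 Cor. 3] -/
theorem qfim_unitary_process_pure [Fintype ι] {W : Matrix n n ℂ} (hW : Wᴴ * W = 1) (hW' : W * Wᴴ = 1) (i₀ : n)
    {h : ι → Matrix n n ℂ} (hh : ∀ a, (h a).IsHermitian) {ρ : Matrix n n ℂ}
    (hρ : ρ = W * diagonal (fun k => ((if k = i₀ then (1 : ℝ) else 0 : ℝ) : ℂ)) * Wᴴ) {S D : ι → Matrix n n ℂ}
    (hD : ∀ a, D a = W * (Complex.I • (h a * diagonal (fun k => ((if k = i₀ then (1 : ℝ) else 0 : ℝ) : ℂ)) -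
      diagonal (fun k => ((if k = i₀ then (1 : ℝ) else 0 : ℝ) : ℂ)) * h a)) * Wᴴ)
    (hSD : ∀ a, S a * ρ + ρ * S a = D a) {F : Matrix ι ι ℝ} (hF : ∀ a b, F a b = 2 * (S a * D b).trace.re)
    (a b : ι) : F a b = 4 * (((h a * h b) i₀ i₀).re - (h a i₀ i₀ * h b i₀ i₀).re) := by
  rw [qfim_unitary_process hW hW' _ hh hρ hD hSD hF a b]
  have hcross : ∑ i, ∑ j, (if i = j then (0 : ℝ) else 8 * (if i = i₀ then (1 : ℝ) else 0) *
      (if j = i₀ then (1 : ℝ) else 0) * (h a i j * h b j i).re /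
        ((if i = i₀ then (1 : ℝ) else 0) + (if j = i₀ then (1 : ℝ) else 0))) = 0 := by
    refine Finset.sum_eq_zero fun i _ => Finset.sum_eq_zero fun j _ => ?_
    by_cases hij : i = j
    · rw [if_pos hij]
    · rw [if_neg hij]
      by_cases hi : i = i₀
      · have hj : j ≠ i₀ := fun hj => hij (hi.trans hj.symm)
        rw [if_neg hj]; simp
      · rw [if_neg hi]; simp
  rw [hcross, sub_zero, Finset.sum_eq_single i₀]
  · simp
  · intro i _ hi
    rw [if_neg hi]; ring
  · intro hi; exact absurd (Finset.mem_univ i₀) hi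

/-- **Single-qubit mixed probe**: for `n = Fin 2` with `λ₀ + λ₁ = 1`,
`𝓕_ab = 4[2Tr(ρ₀²) − 1]Re(⟨λ₀|𝓗_a|λ₁⟩⟨λ₁|𝓗_b|λ₀⟩) = 4[2(λ₀²+λ₁²) − 1]Re(h_a,01 h_b,10)` (and
`cov_{|λ₀⟩}(𝓗_a,𝓗_b) = Re(h_a,01h_b,10)` for a qubit). [cite: LiuYuanLuWang2020, §2.3.4 (displays after Cor. 3)] -/
theorem qfim_unitary_process_qubit [Fintype ι] {W : Matrix (Fin 2) (Fin 2) ℂ} (hW : Wᴴ * W = 1) (hW' : W * Wᴴ = 1)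
    (d : Fin 2 → ℝ) (hd : d 0 + d 1 = 1) {h : ι → Matrix (Fin 2) (Fin 2) ℂ} (hh : ∀ a, (h a).IsHermitian)
    {ρ : Matrix (Fin 2) (Fin 2) ℂ} (hρ : ρ = W * diagonal (fun k => (d k : ℂ)) * Wᴴ) {S D : ι → Matrix (Fin 2) (Fin 2) ℂ}
    (hD : ∀ a, D a = W * (Complex.I • (h a * diagonal (fun k => (d k : ℂ)) - diagonal (fun k => (d k : ℂ)) * h a)) * Wᴴ)
    (hSD : ∀ a, S a * ρ + ρ * S a = D a) {F : Matrix ι ι ℝ} (hF : ∀ a b, F a b = 2 * (S a * D b).trace.re)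
    (a b : ι) : F a b = 4 * (2 * (d 0 ^ 2 + d 1 ^ 2) - 1) * (h a 0 1 * h b 1 0).re := by
  rw [qfim_unitary_process_eigenbasis hW hW' d h hρ hD hSD hF a b]
  have hsymm : (h a 1 0 * h b 0 1).re = (h a 0 1 * h b 1 0).re := by
    have e1 : h a 1 0 = star (h a 0 1) := by rw [← conjTranspose_apply, (hh a).eq]
    have e2 : h b 0 1 = star (h b 1 0) := by rw [← conjTranspose_apply, (hh b).eq]
    rw [e1, e2, ← star_mul, mul_comm, Complex.star_def, Complex.conj_re]
  simp only [Fin.sum_univ_two, sub_self, hsymm]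
  have hd1 : d 1 = 1 - d 0 := by linarith
  rw [hd1]
  have hne : d 0 + (1 - d 0) ≠ 0 := by norm_num
  have hne' : (1 - d 0) + d 0 ≠ 0 := by norm_num
  field_simp
  ring

/-- The diagonal: `𝓕_aa = 4[2Tr(ρ₀²) − 1]|⟨λ₀|𝓗_a|λ₁⟩|²`. [cite: LiuYuanLuWang2020, §2.3.4 («The diagonal entry reads …»)] -/
theorem qfi_unitary_process_qubit [Fintype ι] {W : Matrix (Fin 2) (Fin 2) ℂ} (hW : Wᴴ * W = 1) (hW' : W * Wᴴ = 1)
    (d : Fin 2 → ℝ) (hd : d 0 + d 1 = 1) {h : ι → Matrix (Fin 2) (Fin 2) ℂ} (hh : ∀ a, (h a).IsHermitian)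
    {ρ : Matrix (Fin 2) (Fin 2) ℂ} (hρ : ρ = W * diagonal (fun k => (d k : ℂ)) * Wᴴ) {S D : ι → Matrix (Fin 2) (Fin 2) ℂ}
    (hD : ∀ a, D a = W * (Complex.I • (h a * diagonal (fun k => (d k : ℂ)) - diagonal (fun k => (d k : ℂ)) * h a)) * Wᴴ)
    (hSD : ∀ a, S a * ρ + ρ * S a = D a) {F : Matrix ι ι ℝ} (hF : ∀ a b, F a b = 2 * (S a * D b).trace.re)
    (a : ι) : F a a = 4 * (2 * (d 0 ^ 2 + d 1 ^ 2) - 1) * ‖h a 0 1‖ ^ 2 := by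
  rw [qfim_unitary_process_qubit hW hW' d hd hh hρ hD hSD hF a a]
  have e : h a 1 0 = star (h a 0 1) := by rw [← conjTranspose_apply, (hh a).eq]
  rw [e, Complex.star_def, Complex.mul_conj, Complex.ofReal_re, Complex.normSq_eq_norm_sq]

end Literature.InformationTheory.StateDiscrimination.UnitaryProcess

end
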